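import Summits.QuantumFields.YangMills.Theorems.UnitScaleTiltHalvingOmegaRow
import Summits.QuantumFields.YangMills.Theorems.UnitScaleTiltHalvingOmegaRowWrec
import Summits.QuantumFields.YangMills.Theorems.UnitScaleTiltHalvingCombTorusTower
import Literature.MathematicalPhysics.QuantumFieldTheory.Balaban1983to89.B8Eq131Cubes
import Literature.MathematicalPhysics.QuantumFieldTheory.Balaban1983to89.B8Eq184Proof
import Literature.MathematicalPhysics.QuantumFieldTheory.Balaban1983to89.B8CubeMemberZd
import Literature.Analysis.Calculus.ExpDuhamel
import HarnessLib

/-!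
# Line H (`BirthV10.stub_halvingStep`, stmt-QuantumFields-19200) — (B-al-4)₃'s ω-ROW (F-ω), FILE 3: ★★★ `omegaRow_of_guards` — the in-block oscillation of the averaged
# datum gauge `R̄ʲu₁ = uavg L 1 u₁ j` on the pyramid's label boxes, from the B-al-3 door's own guards, with a closed form `ω_j` GEOMETRIC IN `j`, UNIFORM IN THE NUMBER OF LEVELS
# and free of the row-bound chart constants ([Balaban1985Averaging] (11), (42)–(43), (47), (84)–(85), (99), (163); [Balaban1985RegularSpaces] (1.15), (1.19), (1.29), p.98)

Cell `ym3-torus` (HUMAN RULING D-0037: YM₃ on T³ is ladder rung R3 — NOT d = 4, NOT infinite volume, NOT a mass gap, NOT the Clay problem), width seat `ym3-torus-px9` gen 6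
((F-ω) = px9 g6 per the consumer ym-ust-20520-w3 g9 (α)(β); skeleton `…HalvingEffGaugeRowG.hG_of_rows` row `hOsc`; quantifier-order catch ym-ust-20520-w4 g11 05:33Z).
`--supports stmt-QuantumFields-19200 --as helper`; THEOREMS ONLY (0 `def`, 0 `sorry`); count-neutral; nothing here claims (B-al-4)₃, the (b)-row, (M2′), the stub, the crux or the gap.

WHAT (namespace `…Theorems.HalvingOmegaRowMember`): §1 the tower of blocks (`under_comp`, `under_of_fine_bond`, `under_of_depBox`, `under_one_of_inBox`, `inBox_tower_of_under` — every
fine site read lies under the label `c`, hence in the chart cube `□_k`); §2 member plumbing ((R1) at the flat transporter, `W = u₁⁻¹•U′` is `SU(2)`-valued, the chart radius per bond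
`‖e^{iηA} − 1‖ ≤ e^{c₁} − 1 ≤ ηc′`, monotonicity of the closed form); §3 ★★★ `omegaRow_of_guards` = the skeleton's `hOsc` antecedents VERBATIM (tower∕tree∕(R2) rows accepted, unused)
under OUTER windows (Prop. 2 at `2ε₀`; an auxiliary `αω` with Prop. 2's letters and `e^{3200(d+1)²(d+4)αω} ≤ 11∕10`), concluding `≤ ω_j := x_j + 2a_j + a_j² + (2a_j + a_j²)x_j` with
`x_j = d(L−1)(256(d+1)(d+4)(2ε₀)(Lʲ∕Lᵏ)² + Lʲη·c′max)` (FILE 1 on the TRUE `W`) and `a_j = 64d·Lʲη·c′max` (FILE 2's (99)+(163) on the CUT-OFF chart field `e^{B̃}`, `B̃ = iηA·𝟙_{□_k}`, tower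
height `j`; (84) at the two points by ✓`uavg_flat_eq_local`, its block-axiality transferred from `U′ = u₁•W` by lit ✓`avgIter_congr`∕✓`hol_treeWord_congr`), `c′max = (8·3800((d+2)L)²)⁻¹`
the row's own window, `η = L^{−k}`, `k = K − n`.  HONEST SCOPE: by-name plumbing; the numeric window `ω_j ≤ 1∕600` is the consumer's (an L-only `ε₀`-window).

References: T. Bałaban, CMP **98** (1985) 17–51 [Balaban1985Averaging] ((11) p.19, (42)–(43) pp.23–24, (47) p.25, Prop. 2 (52)–(54) p.26, (84) p.30, (85) p.31, (99) p.32,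
(163) p.42); CMP **99** (1985) 75–102 [Balaban1985RegularSpaces] ((1.15) p.78, (1.19) p.79, (1.29) p.81, (1.69) p.88, p.98).
-/

set_option autoImplicit false

noncomputable section

open scoped BigOperators Matrix.Norms.L2Operator
open NormedSpace
open Complex (I)

namespace Summit.QuantumFields.YangMills.Theorems.HalvingOmegaRowMember

open Literature.MathematicalPhysics.QuantumFieldTheory.Balaban1983to89
open Literature.MathematicalPhysics.QuantumFieldTheory.Balaban1983to89.T3ContinuumYM3Torus
open B7Prop1Explicit renaming Site → LSite
open B7Prop1Explicit (e e_apply boxVec axialFn gaugeAct hol treeWord U1 expUnit val_expUnit)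
open B7Prop1Local (InBox AgreeOn loK bondHiK avgIter_congr hol_treeWord_congr)
open B7Prop2Explicit (avgIter pdev C0 c2' AvgClosed)
open B7Prop2SpecialUnitary (specialUnitaryUnits mem_specialUnitaryUnits specialUnitaryUnits_le_U1)
open B7Prop3Flat (expCfg c3)
open B7Eq92Concrete (mgauge mgauge_one_left)
open B7Eq84Concrete (uavg)
open B7Eq99Concrete (wrec)
open B8Ineq130 (tlo thi tlo_apply thi_apply)
open B8Ineq132 (InAk Under under_tower)
open B8Eq119TwistedAxial (InAx Restr129)
open B8Eq131Cubes (cube sqLo sqHi tLo tHi)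
open B8Eq131Derivation (under_one_block under_one_corner under_succ_of_under_block)
open B8Eq184Proof (cfgExp)
open B8CubeMemberZd (cubeLamS)
open B8Lemma1NonAbelian (lowPart boxVec_nonneg)
open B10Eq27TorusAxialLog (pull unitsField toUField)
open Summit.QuantumFields.YangMills.Theorems.Prop7AxialReprPrint (pull_toUField_mem pdev_pull_lt)
open HalvingCombTorusTower (hblk_of_inAx avgClosed_su2)
open HalvingOmegaRow (norm_inv_mul_sample_sub_one_le)
open HalvingOmegaRowWrec (uavg_flat_eq_local norm_wrec_flat_sub_one_le norm_inv_uavg_mul_uavg_sub_one_le)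

/-! ## §1 The tower of blocks: every fine site read lies under the label -/

section Geometry

variable {d : ℕ}

/-- Depths compose: `y ∈ Bᵐ(x)`, `z ∈ Bⁿ(y)` ⇒ `z ∈ B^{m+n}(x)`. [cite: Balaban1985RegularSpaces, p.79 ("x_n ∈ B(x_{n+1})")] -/
theorem under_comp {L m n : ℕ} {x y z : LSite d} (hy : Under L m x y) (hz : Under L n y z) : Under L (m + n) x z := by
  intro i; obtain ⟨h1, h2⟩ := hy i; obtain ⟨h3, h4⟩ := hz i
  have hLn : (0 : ℤ) ≤ (L : ℤ) ^ n := by positivity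
  constructor
  · calc (L : ℤ) ^ (m + n) * x i = (L : ℤ) ^ n * ((L : ℤ) ^ m * x i) := by ring
      _ ≤ (L : ℤ) ^ n * y i := mul_le_mul_of_nonneg_left h1 hLn
      _ ≤ z i := h3
  · calc z i + 1 ≤ (L : ℤ) ^ n * (y i + 1) := h4
      _ ≤ (L : ℤ) ^ n * ((L : ℤ) ^ m * (x i + 1)) := mul_le_mul_of_nonneg_left h2 hLn
      _ = (L : ℤ) ^ (m + n) * (x i + 1) := by ring

/-- A fine bond of the fine `m`-block of `c` lies under `c`: `Lᵐc ≤ y`, `y + e_μ ≤ Lᵐc + (Lᵐ − 1)𝟙` ⇒ `y ∈ Bᵐ(c)`. [folklore] -/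
theorem under_of_fine_bond {L : ℕ} (m : ℕ) (c y : LSite d) (μ : Fin d)
    (hy : ((L : ℤ) ^ m) • c ≤ y) (hyμ : y + e μ ≤ ((L : ℤ) ^ m) • c + fun _ => (L : ℤ) ^ m - 1) : Under L m c y := by
  intro i; have h1 := hy i; have h2 := hyμ i
  simp only [Pi.smul_apply, smul_eq_mul, Pi.add_apply, e_apply] at h1 h2
  have h0 : (0 : ℤ) ≤ if i = μ then 1 else 0 := by split_ifs <;> norm_num
  exact ⟨h1, by nlinarith⟩

/-- The dependence box of a level-`n` bond `(x, μ′)` of the `n`-fold average (lit ✓`avgIter_congr`: `[Lⁿx, Lⁿx + (Lⁿ − 1)𝟙 + Lⁿe_{μ′}]`) lies under `z` at depth `n + 1` as soon as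
both ends `x`, `x + e_{μ′}` lie in the block `B(Lz)`. [cite: Balaban1985Averaging, p.24 (after (43))] -/
theorem under_of_depBox {L : ℕ} (n : ℕ) {z x : LSite d} {μ' : Fin d} (hx : Under L 1 z x) (hxμ : Under L 1 z (x + e μ'))
    {p : LSite d} (hp : InBox (loK L n x) (bondHiK L n x μ') p) : Under L (n + 1) z p := by
  intro i; obtain ⟨hp1, hp2⟩ := hp i; obtain ⟨hx1, _⟩ := hx i; obtain ⟨_, hxμ2⟩ := hxμ i
  simp only [loK, bondHiK] at hp1 hp2
  simp only [pow_one, Pi.add_apply, e_apply] at hx1 hxμ2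
  have hLn : (0 : ℤ) ≤ (L : ℤ) ^ n := by positivity
  constructor
  · calc (L : ℤ) ^ (n + 1) * z i = (L : ℤ) ^ n * ((L : ℤ) * z i) := by ring
      _ ≤ (L : ℤ) ^ n * x i := mul_le_mul_of_nonneg_left hx1 hLn
      _ ≤ p i := hp1
  · have h3 : p i + 1 ≤ (L : ℤ) ^ n * (x i + (if i = μ' then 1 else 0) + 1) := by
      split_ifs at hp2 ⊢ <;> nlinarith
    calc p i + 1 ≤ (L : ℤ) ^ n * (x i + (if i = μ' then 1 else 0) + 1) := h3
      _ ≤ (L : ℤ) ^ n * ((L : ℤ) * (z i + 1)) := mul_le_mul_of_nonneg_left hxμ2 hLn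
      _ = (L : ℤ) ^ (n + 1) * (z i + 1) := by ring

/-- `B(Lz)` lies under `z`: a site of the block `[Lz, Lz + (L−1)𝟙]` is in `B¹(z)`. [folklore] -/
theorem under_one_of_inBox {L : ℕ} {z x : LSite d} (hx : InBox ((L : ℤ) • z) (((L : ℤ) • z) + fun _ => (L : ℤ) - 1) x) : Under L 1 z x := by
  intro i; obtain ⟨h1, h2⟩ := hx i; simp only [Pi.smul_apply, smul_eq_mul, Pi.add_apply] at h1 h2
  rw [pow_one]; constructor <;> linarith

/-- **Descent to the chart cube**: a label `c` of the depth-`m₀` box and a fine site `p ∈ Bᵐ(c)` give `p` in the depth-`(m₀ + m)` box (lit ✓`under_tower`, repackaged as `InBox`).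
[cite: Balaban1985RegularSpaces, p.98 ("for every j the cube □_j is a sum of the big blocks")] -/
theorem inBox_tower_of_under {L : ℕ} {lo hi : LSite d} {m₀ m : ℕ} {c p : LSite d} (hc : InBox (tlo L lo m₀) (thi L hi m₀) c) (hp : Under L m c p) :
    InBox (tlo L lo (m₀ + m)) (thi L hi (m₀ + m)) p := by
  have h := under_tower (fun i => (hc i).1) (fun i => (hc i).2) hp; exact fun i => ⟨h.1 i, h.2 i⟩

end Geometry

/-! ## §2 Member plumbing: (R1) at the flat transporter, `W` is `SU(2)`-valued, the chart radius per bond, the cut-off exponent -/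

section Plumbing

variable {d : ℕ}

/-- (R1) `mgauge 1 u W = U′` is the gauge action (8) at the flat transporter. [cite: Balaban1985Averaging, (55) p.27, (8) p.18] -/
theorem gaugeAct_of_mgauge_one {G : Type*} [Group G] {u : LSite d → G} {W U' : LSite d → Fin d → G}
    (h : mgauge (1 : LSite d → Fin d → G) u W = U') : gaugeAct u W = U' := by
  rwa [mgauge_one_left] at h

/-- From `u•W = U′`: `W(x, κ) = u(x)⁻¹·U′(x, κ)·u(x + e_κ)`. [cite: Balaban1985Averaging, (8) p.18] -/
theorem apply_eq_of_gaugeAct {G : Type*} [Group G] {u : LSite d → G} {W U' : LSite d → Fin d → G} (h : gaugeAct u W = U') (x : LSite d) (κ : Fin d) :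
    W x κ = (u x)⁻¹ * U' x κ * u (x + e κ) := by
  have hx := congrFun (congrFun h x) κ; simp only [gaugeAct] at hx; rw [← hx]; group

/-- **`W = u₁⁻¹•U′` is `SU(2)`-valued** when `u₁` and `U′` are. [cite: Balaban1985Averaging, (8) p.18, p.20] -/
theorem mem_su2_of_gaugeAct {N : ℕ} {u : LSite d → (Matrix (Fin N) (Fin N) ℂ)ˣ} {W U' : LSite d → Fin d → (Matrix (Fin N) (Fin N) ℂ)ˣ}
    (h : gaugeAct u W = U') (hu : ∀ z, ((u z : (Matrix (Fin N) (Fin N) ℂ)ˣ) : Matrix (Fin N) (Fin N) ℂ) ∈ Matrix.specialUnitaryGroup (Fin N) ℂ)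
    (hU : ∀ x κ, U' x κ ∈ specialUnitaryUnits (Fin N)) (x : LSite d) (κ : Fin d) : W x κ ∈ specialUnitaryUnits (Fin N) := by
  rw [apply_eq_of_gaugeAct h x κ]
  exact (specialUnitaryUnits (Fin N)).mul_mem ((specialUnitaryUnits (Fin N)).mul_mem
    ((specialUnitaryUnits (Fin N)).inv_mem (mem_specialUnitaryUnits.2 (hu x))) (hU x κ)) (mem_specialUnitaryUnits.2 (hu _))

variable {𝔸 : Type*} [NormedRing 𝔸] [NormedAlgebra ℂ 𝔸] [NormOneClass 𝔸] [CompleteSpace 𝔸]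

omit [NormOneClass 𝔸] in
/-- **THE CHART RADIUS PER BOND**: `‖e^{iηA} − 1‖ ≤ e^{η‖A‖} − 1 ≤ e^{c₁} − 1 ≤ t` for `η‖A‖ ≤ c₁` (`η ≥ 0`), `e^{c₁} − 1 ≤ t`. [cite: Balaban1985RegularSpaces, (1.69) p.88; Balaban1985Averaging, (27) p.22] -/
theorem norm_cfgExp_sub_one_le {η : ℝ} (hη : 0 ≤ η) (A : LSite d → Fin d → 𝔸) (z : LSite d) (ν : Fin d) {c₁ t : ℝ} (hA : η * ‖A z ν‖ ≤ c₁)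
    (ht : Real.exp c₁ - 1 ≤ t) : ‖((cfgExp η A z ν : 𝔸ˣ) : 𝔸) - 1‖ ≤ t := by
  letI : NormedAlgebra ℝ 𝔸 := NormedAlgebra.restrictScalars ℝ ℂ 𝔸
  letI : NormedAlgebra ℚ 𝔸 := NormedAlgebra.restrictScalars ℚ ℂ 𝔸
  have h1 : ‖((cfgExp η A z ν : 𝔸ˣ) : 𝔸) - 1‖ ≤ Real.exp ‖I • (η • A z ν)‖ - 1 := by
    unfold cfgExp
    rw [val_expUnit]
    exact Literature.Analysis.Calculus.norm_exp_sub_one_le _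
  have h2 : ‖I • (η • A z ν)‖ = η * ‖A z ν‖ := by rw [norm_smul, Complex.norm_I, one_mul, norm_smul, Real.norm_eq_abs, abs_of_nonneg hη]
  rw [h2] at h1; linarith [Real.exp_le_exp.2 hA]

omit [NormedAlgebra ℂ 𝔸] [NormOneClass 𝔸] [CompleteSpace 𝔸] in
/-- From the chart letters: `η‖A‖ ≤ c₁` and `e^{c₁} − 1 ≤ η·c′` give `η‖A‖ ≤ η·c′` (`t ≤ e^{t} − 1`). [folklore] -/
theorem eta_norm_le_of_chart {η : ℝ} (A : LSite d → Fin d → 𝔸) (z : LSite d) (ν : Fin d) {c₁ c' : ℝ} (hA : η * ‖A z ν‖ ≤ c₁)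
    (hexp : Real.exp c₁ - 1 ≤ η * c') : η * ‖A z ν‖ ≤ η * c' := by
  have h := Real.add_one_le_exp c₁
  linarith

omit [NormedAlgebra ℂ 𝔸] [NormOneClass 𝔸] [CompleteSpace 𝔸] in
/-- The closed form `x + 2a + a² + (2a + a²)x` is monotone in `x, a ≥ 0`. [folklore] -/
theorem omegaForm_mono {x x' a a' : ℝ} (hx0 : 0 ≤ x) (ha0 : 0 ≤ a) (hx : x ≤ x') (ha : a ≤ a') :
    x + 2 * a + a ^ 2 + (2 * a + a ^ 2) * x ≤ x' + 2 * a' + a' ^ 2 + (2 * a' + a' ^ 2) * x' := by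
  have ha0' : 0 ≤ a' := ha0.trans ha
  have h2 : a ^ 2 ≤ a' ^ 2 := pow_le_pow_left₀ ha0 ha 2
  have h3 : (2 * a + a ^ 2) * x ≤ (2 * a' + a' ^ 2) * x' := mul_le_mul (by linarith) hx hx0 (by positivity)
  linarith

end Plumbing

/-! ## §3 ★★★ The member corollary: the skeleton's row `hOsc` -/

section Member

variable (F : T3Family) {n K : ℕ}

set_option maxHeartbeats 400000 in
/-- ★★★ **(F-ω) AT THE MEMBER — THE IN-BLOCK OSCILLATION OF `R̄ʲu₁` ON THE PYRAMID's LABEL BOXES** (the skeleton's row `hOsc`): under the B-al-3 door ✓p696030's `hG`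
antecedents and the outer windows, for every `j < K − n`, every label `c` of the level-`(j+1)` box and every `r ∈ [0, L)ᵈ`: `‖R̄ʲu₁(Lc)⁻¹·R̄ʲu₁(Lc + r) − 1‖ ≤ ω_j`, `ω_j` the closed
form of the header (FILE 1 on the true `W` for the `u₁`-samples; FILE 2's (99)+(163) on the cut-off chart field at tower height `j` for the frames; (84) at the two points, locally;
`c′ ≤ c′max` by the row's window). [cite: Balaban1985Averaging, (11) p.19, (47) p.25, Prop. 2 (54) p.26, (84) p.30, (85) p.31, (99) p.32, (163) p.42; Balaban1985RegularSpaces, (1.15) p.78, (1.19) p.79, (1.29) p.81, p.98] -/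
theorem omegaRow_of_guards {ε₀ : ℝ} (hε₀ : 0 < ε₀)
    (hα3 : C0 (F.P K).d * (2 * ε₀) ≤ 1 / 3) (hα2 : 2 * (2 * ε₀) ≤ c2' (F.P K).d (F.P K).L)
    {αω : ℝ} (hαω : 0 < αω) (hαω3 : C0 (F.P K).d * αω ≤ 1 / 3) (hαω4 : 4 * αω ≤ c2' (F.P K).d (F.P K).L)
    (hαωexp : Real.exp (4 * (800 * (((F.P K).d : ℝ) + 1) ^ 2 * (((F.P K).d : ℝ) + 4)) * αω) ≤ 11 / 10)
    (a : LSite (F.P K).d) (M' ρ' : ℕ) (s : ℝ) (U : GaugeField (F.P K) 0 (Matrix.specialUnitaryGroup (Fin 2) ℂ)) :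
    ∀ (gJ : GaugeTransf (F.P K) 0 (Matrix.specialUnitaryGroup (Fin 2) ℂ)) (u₁ : LSite (F.P K).d → (Matrix (Fin 2) (Fin 2) ℂ)ˣ)
        (W : LSite (F.P K).d → Fin (F.P K).d → (Matrix (Fin 2) (Fin 2) ℂ)ˣ) (A : LSite (F.P K).d → Fin (F.P K).d → Matrix (Fin 2) (Fin 2) ℂ) (c₁ c' : ℝ),
      InAk (F.P K).L (K - n) (((F.L : ℝ)⁻¹) ^ (K - n)) ε₀ (fun _ => (Set.univ : Set (LSite (F.P K).d))) (pull (unitsField (toUField (GaugeField.gaugeAct gJ U))) 0) →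
      (∀ m', m' ≤ K - n → ∀ Λ : ℕ → Set (LSite (F.P K).d), InAx (F.P K).L m' Λ (1 : LSite (F.P K).d → Fin (F.P K).d → (Matrix (Fin 2) (Fin 2) ℂ)ˣ) (pull (unitsField (toUField (GaugeField.gaugeAct gJ U))) 0)) →
      (∀ m', m' ≤ K - n → ∀ (x : LSite (F.P K).d) (ν : Fin (F.P K).d), tlo (F.P K).L (tLo a ρ') m' ≤ x → x + e ν ≤ thi (F.P K).L (tHi a M' ρ') m' →
        ‖((avgIter (F.P K).L (pull (unitsField (toUField (GaugeField.gaugeAct gJ U))) 0) (K - n - m') x ν : (Matrix (Fin 2) (Fin 2) ℂ)ˣ) : Matrix (Fin 2) (Fin 2) ℂ) - 1‖ < s) →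
      (∀ (x : LSite (F.P K).d) (ν : Fin (F.P K).d), tLo a ρ' ≤ x → x + e ν ≤ tHi a M' ρ' → lowPart ν (x - tLo a ρ') = 0 →
        avgIter (F.P K).L (pull (unitsField (toUField (GaugeField.gaugeAct gJ U))) 0) (K - n) x ν = 1) →
      (∀ z, ((u₁ z : (Matrix (Fin 2) (Fin 2) ℂ)ˣ) : Matrix (Fin 2) (Fin 2) ℂ) ∈ Matrix.specialUnitaryGroup (Fin 2) ℂ) →
      mgauge (1 : LSite (F.P K).d → Fin (F.P K).d → (Matrix (Fin 2) (Fin 2) ℂ)ˣ) u₁ W = pull (unitsField (toUField (GaugeField.gaugeAct gJ U))) 0 →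
      0 ≤ c' → 8 * 3800 * ((((F.P K).d + 2) * (F.P K).L : ℕ) : ℝ) ^ 2 * c' ≤ 1 → Real.exp c₁ - 1 ≤ ((F.L : ℝ)⁻¹) ^ (K - n) * c' →
      (∀ z ∈ cube (F.P K).L a M' ρ' (K - n) (K - n), ∀ ν : Fin (F.P K).d, W z ν = cfgExp (((F.L : ℝ)⁻¹) ^ (K - n)) A z ν ∧ ((F.L : ℝ)⁻¹) ^ (K - n) * ‖A z ν‖ ≤ c₁) →
      Restr129 (F.P K).L (K - n) (cubeLamS (F.P K).L a M' ρ' (K - n) (K - n)) (1 : LSite (F.P K).d → Fin (F.P K).d → (Matrix (Fin 2) (Fin 2) ℂ)ˣ) u₁ →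
      ∀ j, j < K - n → ∀ c : LSite (F.P K).d,
        InBox (tlo (F.P K).L (sqLo (F.P K).L a ρ' (K - n) (K - n)) (K - n - (j + 1))) (thi (F.P K).L (sqHi (F.P K).L a M' ρ' (K - n) (K - n)) (K - n - (j + 1))) c →
        ∀ r : Fin (F.P K).d → Fin (F.P K).L,
          ‖((((uavg (F.P K).L (1 : LSite (F.P K).d → Fin (F.P K).d → (Matrix (Fin 2) (Fin 2) ℂ)ˣ) u₁ j (((F.P K).L : ℤ) • c))⁻¹ *
              uavg (F.P K).L (1 : LSite (F.P K).d → Fin (F.P K).d → (Matrix (Fin 2) (Fin 2) ℂ)ˣ) u₁ j (((F.P K).L : ℤ) • c + boxVec (F.P K).L r)) :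
            (Matrix (Fin 2) (Fin 2) ℂ)ˣ) : Matrix (Fin 2) (Fin 2) ℂ) - 1‖ ≤
            (((F.P K).d : ℝ) * (((F.P K).L : ℝ) - 1)) * (256 * (((F.P K).d : ℝ) + 1) * (((F.P K).d : ℝ) + 4) * (2 * ε₀) * (((F.P K).L : ℝ) ^ j * (((F.P K).L : ℝ) ^ (K - n))⁻¹) ^ 2 +
                ((F.P K).L : ℝ) ^ j * (((F.L : ℝ)⁻¹) ^ (K - n) * (8 * 3800 * ((((F.P K).d + 2) * (F.P K).L : ℕ) : ℝ) ^ 2)⁻¹))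
              + 2 * (64 * ((F.P K).d : ℝ) * (((F.P K).L : ℝ) ^ j * (((F.L : ℝ)⁻¹) ^ (K - n) * (8 * 3800 * ((((F.P K).d + 2) * (F.P K).L : ℕ) : ℝ) ^ 2)⁻¹)))
              + (64 * ((F.P K).d : ℝ) * (((F.P K).L : ℝ) ^ j * (((F.L : ℝ)⁻¹) ^ (K - n) * (8 * 3800 * ((((F.P K).d + 2) * (F.P K).L : ℕ) : ℝ) ^ 2)⁻¹))) ^ 2
              + (2 * (64 * ((F.P K).d : ℝ) * (((F.P K).L : ℝ) ^ j * (((F.L : ℝ)⁻¹) ^ (K - n) * (8 * 3800 * ((((F.P K).d + 2) * (F.P K).L : ℕ) : ℝ) ^ 2)⁻¹))) +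
                  (64 * ((F.P K).d : ℝ) * (((F.P K).L : ℝ) ^ j * (((F.L : ℝ)⁻¹) ^ (K - n) * (8 * 3800 * ((((F.P K).d + 2) * (F.P K).L : ℕ) : ℝ) ^ 2)⁻¹))) ^ 2) *
                ((((F.P K).d : ℝ) * (((F.P K).L : ℝ) - 1)) * (256 * (((F.P K).d : ℝ) + 1) * (((F.P K).d : ℝ) + 4) * (2 * ε₀) * (((F.P K).L : ℝ) ^ j * (((F.P K).L : ℝ) ^ (K - n))⁻¹) ^ 2 +
                  ((F.P K).L : ℝ) ^ j * (((F.L : ℝ)⁻¹) ^ (K - n) * (8 * 3800 * ((((F.P K).d + 2) * (F.P K).L : ℕ) : ℝ) ^ 2)⁻¹))) := by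
  intro gJ u₁ W A c₁ c' hInAk hInAx _ _ hu₁ hR1m hc' h3800 hexp hcube _ j hj c hc r
  classical
  -- letters
  set k : ℕ := K - n with hk
  set η : ℝ := ((F.L : ℝ)⁻¹) ^ (K - n) with hη
  set U' : LSite (F.P K).d → Fin (F.P K).d → (Matrix (Fin 2) (Fin 2) ℂ)ˣ := pull (unitsField (toUField (GaugeField.gaugeAct gJ U))) 0 with hU'
  have hFL : ((F.P K).L : ℝ) = (F.L : ℝ) := rfl
  have hL2 : 2 ≤ (F.P K).L := (F.P K).hL.2; have hL1 : 1 ≤ (F.P K).L := le_trans (by norm_num) hL2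
  have hL3 : 3 ≤ (F.P K).L := by have hodd : Odd (F.P K).L := F.hL.1; obtain ⟨t, ht⟩ := hodd; omega
  have hLr3 : (3 : ℝ) ≤ ((F.P K).L : ℝ) := by exact_mod_cast hL3
  have hLr0 : (0 : ℝ) < ((F.P K).L : ℝ) := by linarith
  have hdr : ((F.P K).d : ℝ) = 3 := by rw [T3Family.P_d F K]; norm_num
  have hη0 : 0 ≤ η := by rw [hη]; positivity
  have hηc : 0 ≤ η * c' := mul_nonneg hη0 hc'
  -- (R1), the groups, the guards
  have hR1 : gaugeAct u₁ W = U' := gaugeAct_of_mgauge_one hR1m; have hU'G := fun x κ => pull_toUField_mem (GaugeField.gaugeAct gJ U) 0 x κ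
  have hWG : ∀ x κ, W x κ ∈ specialUnitaryUnits (Fin 2) := mem_su2_of_gaugeAct hR1 hu₁ hU'G
  have hG : AvgClosed (F.P K).d (F.P K).L (specialUnitaryUnits (Fin 2)) := avgClosed_su2 (F.P K).d (F.P K).L
  have huU1 : ∀ x, u₁ x ∈ U1 (Matrix (Fin 2) (Fin 2) ℂ) := fun x => specialUnitaryUnits_le_U1 (mem_specialUnitaryUnits.2 (hu₁ x))
  have h52 : pdev U' < 2 * ε₀ * ((((F.P K).L : ℝ) ^ k)⁻¹) ^ 2 := pdev_pull_lt hε₀ hInAk 0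
  have hblk := hblk_of_inAx U' hInAx
  -- the chart on the fine cube
  have hchart : ∀ y ∈ cube (F.P K).L a M' ρ' k k, ∀ μ : Fin (F.P K).d, ‖((W y μ : (Matrix (Fin 2) (Fin 2) ℂ)ˣ) : Matrix (Fin 2) (Fin 2) ℂ) - 1‖ ≤ η * c' := by
    intro y hy μ; obtain ⟨hW, hA⟩ := hcube y hy μ; rw [hW]; exact norm_cfgExp_sub_one_le hη0 A y μ hA hexp
  have hcubeOf : ∀ p : LSite (F.P K).d, Under (F.P K).L (j + 1) c p → p ∈ cube (F.P K).L a M' ρ' k k := by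
    intro p hp; have h := inBox_tower_of_under hc hp; rwa [show k - (j + 1) + (j + 1) = k by omega] at h
  -- (x) FILE 1 on the true `W` at level `j`, block `c`
  have hax : ∀ r' : Fin (F.P K).d → Fin (F.P K).L,
      axialFn (avgIter (F.P K).L U' j) (((F.P K).L : ℤ) • c) (((F.P K).L : ℤ) • c + boxVec (F.P K).L r') = 1 := by
    intro r'; have h := hblk (k - 1 - j) (by omega) c r'; rwa [show k - (k - 1 - j + 1) = j by omega] at h
  have hw : ∀ (y : LSite (F.P K).d) (μ : Fin (F.P K).d), (((F.P K).L : ℤ) ^ (j + 1)) • c ≤ y →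
      y + e μ ≤ (((F.P K).L : ℤ) ^ (j + 1)) • c + (fun _ => ((F.P K).L : ℤ) ^ (j + 1) - 1) →
      ‖((W y μ : (Matrix (Fin 2) (Fin 2) ℂ)ˣ) : Matrix (Fin 2) (Fin 2) ℂ) - 1‖ ≤ η * c' :=
    fun y μ hy hyμ => hchart y (hcubeOf y (under_of_fine_bond (j + 1) c y μ hy hyμ)) μ
  have hX := norm_inv_mul_sample_sub_one_le (F.P K).L hL2 hG k U' W hWG u₁ huU1 hR1 (α₀ := 2 * ε₀) (by positivity) hα3 hα2 h52
    hj.le c hax hηc hw r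
  -- (a) FILE 2 §2 on the cut-off chart field `W̃ = e^{B̃}`, tower height `j`
  set Bt : LSite (F.P K).d → Fin (F.P K).d → Matrix (Fin 2) (Fin 2) ℂ :=
    fun x μ => if x ∈ cube (F.P K).L a M' ρ' k k then I • (η • A x μ) else 0 with hBt
  have hBtb : ∀ x μ, ‖Bt x μ‖ ≤ η * c' := by
    intro x μ; simp only [hBt]; split_ifs with hx
    · rw [norm_smul, Complex.norm_I, one_mul, norm_smul, Real.norm_eq_abs, abs_of_nonneg hη0]; exact eta_norm_le_of_chart A x μ (hcube x hx μ).2 hexp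
    · rw [norm_zero]; exact hηc
  -- the windows of (163) at tower height `j`: `Lʲ·ηc′ ≤ c′∕L`
  have hc'1 : c' ≤ 1 / (8 * 3800 * ((((F.P K).d + 2) * (F.P K).L : ℕ) : ℝ) ^ 2) := by
    have hpos : (0 : ℝ) < 8 * 3800 * ((((F.P K).d + 2) * (F.P K).L : ℕ) : ℝ) ^ 2 := by
      have : (1 : ℝ) ≤ ((((F.P K).d + 2) * (F.P K).L : ℕ) : ℝ) := by
        have h1 : 1 ≤ ((F.P K).d + 2) * (F.P K).L := Nat.one_le_iff_ne_zero.mpr (by positivity)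
        exact_mod_cast h1
      positivity
    rw [le_div_iff₀ hpos]; linarith
  have hcast : ((((F.P K).d + 2) * (F.P K).L : ℕ) : ℝ) = 5 * ((F.P K).L : ℝ) := by push_cast; rw [hdr]; ring
  have hc'L2 : c' * ((F.P K).L : ℝ) ^ 2 ≤ 1 / 760000 := by
    rw [hcast] at hc'1
    have hpos : (0 : ℝ) < 8 * 3800 * (5 * ((F.P K).L : ℝ)) ^ 2 := by positivity
    have h := (le_div_iff₀ hpos).1 hc'1
    have e : c' * (8 * 3800 * (5 * ((F.P K).L : ℝ)) ^ 2) = 760000 * (c' * ((F.P K).L : ℝ) ^ 2) := by ring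
    rw [e] at h
    rw [le_div_iff₀ (by norm_num : (0 : ℝ) < 760000)]
    linarith
  have hLjη : ((F.P K).L : ℝ) ^ j * η * (F.P K).L ≤ 1 := by
    rw [hη, ← hFL, inv_pow]
    have hjk : j + 1 ≤ k := hj
    have h1 : ((F.P K).L : ℝ) ^ j * (F.P K).L = ((F.P K).L : ℝ) ^ (j + 1) := by ring
    have h2 : ((F.P K).L : ℝ) ^ (j + 1) ≤ ((F.P K).L : ℝ) ^ k := pow_le_pow_right₀ (by linarith) hjk
    have h3 : 0 < ((F.P K).L : ℝ) ^ k := by positivity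
    calc ((F.P K).L : ℝ) ^ j * (((F.P K).L : ℝ) ^ (K - n))⁻¹ * (F.P K).L = ((F.P K).L : ℝ) ^ (j + 1) * (((F.P K).L : ℝ) ^ k)⁻¹ := by rw [hk]; ring
      _ ≤ ((F.P K).L : ℝ) ^ k * (((F.P K).L : ℝ) ^ k)⁻¹ := mul_le_mul_of_nonneg_right h2 (by positivity)
      _ = 1 := mul_inv_cancel₀ h3.ne'
  -- `t := Lʲ·b = Lʲηc′ ≤ c′∕L ≤ 1∕(760000·L³)`
  set t : ℝ := ((F.P K).L : ℝ) ^ j * (η * c') with ht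
  have ht0 : 0 ≤ t := by rw [ht]; positivity
  have htL3 : t * ((F.P K).L : ℝ) ^ 3 ≤ 1 / 760000 := by
    have h1 : t * ((F.P K).L : ℝ) ^ 3 = (((F.P K).L : ℝ) ^ j * η * (F.P K).L) * (c' * ((F.P K).L : ℝ) ^ 2) := by rw [ht]; ring
    rw [h1]
    have h2 : 0 ≤ c' * ((F.P K).L : ℝ) ^ 2 := by positivity
    calc _ ≤ 1 * (c' * ((F.P K).L : ℝ) ^ 2) := mul_le_mul_of_nonneg_right hLjη h2
      _ ≤ 1 / 760000 := by rw [one_mul]; exact hc'L2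
  have h27 : (27 : ℝ) ≤ ((F.P K).L : ℝ) ^ 3 := by have h := pow_le_pow_left₀ (by norm_num : (0 : ℝ) ≤ 3) hLr3 3; norm_num at h; exact h
  have ht27 : t ≤ 1 / (760000 * 27) := by
    have : t * 27 ≤ 1 / 760000 := (mul_le_mul_of_nonneg_left h27 ht0).trans htL3; rw [le_div_iff₀ (by norm_num)]; linarith
  have htL : t * ((F.P K).L : ℝ) ≤ 1 / (760000 * 9) := by
    have h9 : (9 : ℝ) ≤ ((F.P K).L : ℝ) ^ 2 := by nlinarith
    have h1 : t * ((F.P K).L : ℝ) * 9 ≤ t * ((F.P K).L : ℝ) ^ 3 := by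
      have e : t * ((F.P K).L : ℝ) ^ 3 = t * ((F.P K).L : ℝ) * ((F.P K).L : ℝ) ^ 2 := by ring
      rw [e]
      exact mul_le_mul_of_nonneg_left h9 (by positivity)
    rw [le_div_iff₀ (by norm_num)]; linarith
  have hsmallω : Real.exp (4 * (800 * (((F.P K).d : ℝ) + 1) ^ 2 * (((F.P K).d : ℝ) + 4)) * αω) *
      (1 + 8 * (131072 * (((F.P K).d : ℝ) + 1) ^ 2) * (((F.P K).L : ℝ) ^ j * (η * c'))) ≤ 2 := by
    rw [← ht]
    have h1 : 1 + 8 * (131072 * (((F.P K).d : ℝ) + 1) ^ 2) * t ≤ 18177 / 10000 := by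
      rw [hdr]
      have e : 8 * (131072 * ((3 : ℝ) + 1) ^ 2) * t = 16777216 * t := by ring
      rw [e]
      linarith
    have h0 : 0 ≤ 1 + 8 * (131072 * (((F.P K).d : ℝ) + 1) ^ 2) * t := by positivity
    calc _ ≤ (11 / 10) * (18177 / 10000) := mul_le_mul hαωexp h1 h0 (by norm_num)
      _ ≤ 2 := by norm_num
  have hc3ω : 2 * (((F.P K).L : ℝ) ^ j * (η * c')) ≤ c3 (F.P K).d (F.P K).L := by
    rw [← ht, B7Prop3Flat.c3, hdr]
    rw [le_div_iff₀ (by positivity)]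
    have e : 2 * t * (128 * ((3 : ℝ) + 1) * ((F.P K).L : ℝ)) = 1024 * (t * ((F.P K).L : ℝ)) := by ring
    rw [e]
    linarith
  have hsmω : 2048 * ((F.P K).d : ℝ) * (((F.P K).L : ℝ) ^ j * (η * c')) ≤ 1 := by rw [← ht, hdr]; linarith
  have ha : ∀ y : LSite (F.P K).d,
      ‖((wrec (F.P K).L (1 : LSite (F.P K).d → Fin (F.P K).d → (Matrix (Fin 2) (Fin 2) ℂ)ˣ) (expCfg Bt) j y : (Matrix (Fin 2) (Fin 2) ℂ)ˣ) : Matrix (Fin 2) (Fin 2) ℂ) - 1‖ ≤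
          64 * ((F.P K).d : ℝ) * (((F.P K).L : ℝ) ^ j * (η * c')) ∧
        ‖(((wrec (F.P K).L (1 : LSite (F.P K).d → Fin (F.P K).d → (Matrix (Fin 2) (Fin 2) ℂ)ˣ) (expCfg Bt) j y)⁻¹ : (Matrix (Fin 2) (Fin 2) ℂ)ˣ) : Matrix (Fin 2) (Fin 2) ℂ) - 1‖ ≤
          64 * ((F.P K).d : ℝ) * (((F.P K).L : ℝ) ^ j * (η * c')) := fun y =>
    norm_wrec_flat_sub_one_le (F.P K).L hL2 hG j Bt hηc hBtb hαω hαω3 hαω4 hsmallω hc3ω hsmω le_rfl y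
  -- (84) at the two points, with `W̃`: block-axiality of `u₁•W̃` under them transferred from `U′ = u₁•W`
  have hWt : ∀ p ∈ cube (F.P K).L a M' ρ' k k, ∀ ν : Fin (F.P K).d, expCfg Bt p ν = W p ν := by
    intro p hp ν; rw [(hcube p hp ν).1]; show expUnit (Bt p ν) = cfgExp η A p ν; simp only [hBt, if_pos hp]; rfl
  have hloc : ∀ y : LSite (F.P K).d, Under (F.P K).L 1 c y → ∀ n', n' < j → ∀ z : LSite (F.P K).d, Under (F.P K).L (j - (n' + 1)) y z →
      ∀ r' : Fin (F.P K).d → Fin (F.P K).L,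
        axialFn (avgIter (F.P K).L (gaugeAct u₁ (expCfg Bt)) n') (((F.P K).L : ℤ) • z) (((F.P K).L : ℤ) • z + boxVec (F.P K).L r') = 1 := by
    intro y hy n' hn' z hz r'
    have hzc : Under (F.P K).L (j - n') c z := by
      have h := under_succ_of_under_block hy hz; rwa [show j - (n' + 1) + 1 = j - n' by omega] at h
    have hagree : AgreeOn (((F.P K).L : ℤ) • z) ((((F.P K).L : ℤ) • z) + fun _ => ((F.P K).L : ℤ) - 1)
        (avgIter (F.P K).L (gaugeAct u₁ (expCfg Bt)) n') (avgIter (F.P K).L U' n') := by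
      intro x μ hx hxμ
      refine avgIter_congr (F.P K).L hL1 n' x μ fun p ν hp _ => ?_
      have hpz : Under (F.P K).L (n' + 1) z p := under_of_depBox n' (under_one_of_inBox hx) (under_one_of_inBox hxμ) hp
      have hpc : Under (F.P K).L (j + 1) c p := by have h := under_comp hzc hpz; rwa [show j - n' + (n' + 1) = j + 1 by omega] at h
      rw [← hR1]; simp only [gaugeAct, hWt p (hcubeOf p hpc) ν]
    have hL2z : (2 : ℤ) ≤ (F.P K).L := by exact_mod_cast hL2
    have hLpos : (0 : ℤ) ≤ ((F.P K).L : ℤ) - 1 := by linarith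
    have hp0 : InBox (((F.P K).L : ℤ) • z) ((((F.P K).L : ℤ) • z) + fun _ => ((F.P K).L : ℤ) - 1) (((F.P K).L : ℤ) • z) := fun i => by
      simp only [Pi.add_apply]; constructor <;> linarith
    have hpv : InBox (((F.P K).L : ℤ) • z) ((((F.P K).L : ℤ) • z) + fun _ => ((F.P K).L : ℤ) - 1) (((F.P K).L : ℤ) • z + boxVec (F.P K).L r') := fun i => by
      simp only [Pi.add_apply, boxVec]
      have h1 := (r' i).isLt
      have h2 : (0 : ℤ) ≤ ((r' i : ℕ) : ℤ) := Int.natCast_nonneg _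
      have h3 : ((r' i : ℕ) : ℤ) ≤ ((F.P K).L : ℤ) - 1 := by omega
      constructor <;> linarith
    have hU : axialFn (avgIter (F.P K).L U' n') (((F.P K).L : ℤ) • z) (((F.P K).L : ℤ) • z + boxVec (F.P K).L r') = 1 := by
      have h := hblk (k - 1 - n') (by omega) z r'; rwa [show k - (k - 1 - n' + 1) = n' by omega] at h
    unfold axialFn at hU ⊢
    rw [add_sub_cancel_left] at hU ⊢; rw [hol_treeWord_congr hagree _ _ hp0 hpv]; exact hU
  have h84 : ∀ y : LSite (F.P K).d, Under (F.P K).L 1 c y →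
      uavg (F.P K).L (1 : LSite (F.P K).d → Fin (F.P K).d → (Matrix (Fin 2) (Fin 2) ℂ)ˣ) u₁ j y =
        u₁ ((((F.P K).L : ℤ) ^ j) • y) * wrec (F.P K).L (1 : LSite (F.P K).d → Fin (F.P K).d → (Matrix (Fin 2) (Fin 2) ℂ)ˣ) (expCfg Bt) j y :=
    fun y hy => uavg_flat_eq_local (F.P K).L hL1 (expCfg Bt) u₁ j y (hloc y hy)
  -- assemble
  have hmain := norm_inv_uavg_mul_uavg_sub_one_le (F.P K).L (expCfg Bt) u₁ j c r (h84 _ (under_one_corner hL1 c))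
    (h84 _ (under_one_block (F.P K).L c r)) hX (ha _).2 (ha _).1
  -- the row's letter `ω` may not read `c′`: majorise by the row's own window `c′ ≤ (8·3800((d+2)L)²)⁻¹`
  have hcmax : c' ≤ (8 * 3800 * ((((F.P K).d + 2) * (F.P K).L : ℕ) : ℝ) ^ 2)⁻¹ := by rw [← one_div]; exact hc'1
  have hηle : η * c' ≤ η * (8 * 3800 * ((((F.P K).d + 2) * (F.P K).L : ℕ) : ℝ) ^ 2)⁻¹ := mul_le_mul_of_nonneg_left hcmax hη0
  have hLj0 : 0 ≤ ((F.P K).L : ℝ) ^ j := by positivity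
  have hD0 : 0 ≤ ((F.P K).d : ℝ) * (((F.P K).L : ℝ) - 1) := mul_nonneg (Nat.cast_nonneg _) (by linarith)
  have htle : t ≤ ((F.P K).L : ℝ) ^ j * (η * (8 * 3800 * ((((F.P K).d + 2) * (F.P K).L : ℕ) : ℝ) ^ 2)⁻¹) := by
    rw [ht]; exact mul_le_mul_of_nonneg_left hηle hLj0
  have hx0 : 0 ≤ ((F.P K).d : ℝ) * (((F.P K).L : ℝ) - 1) *
      (256 * (((F.P K).d : ℝ) + 1) * (((F.P K).d : ℝ) + 4) * (2 * ε₀) * (((F.P K).L : ℝ) ^ j * (((F.P K).L : ℝ) ^ k)⁻¹) ^ 2 + t) :=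
    mul_nonneg hD0 (by positivity)
  have hxle : ((F.P K).d : ℝ) * (((F.P K).L : ℝ) - 1) *
      (256 * (((F.P K).d : ℝ) + 1) * (((F.P K).d : ℝ) + 4) * (2 * ε₀) * (((F.P K).L : ℝ) ^ j * (((F.P K).L : ℝ) ^ k)⁻¹) ^ 2 + t) ≤
      ((F.P K).d : ℝ) * (((F.P K).L : ℝ) - 1) *
      (256 * (((F.P K).d : ℝ) + 1) * (((F.P K).d : ℝ) + 4) * (2 * ε₀) * (((F.P K).L : ℝ) ^ j * (((F.P K).L : ℝ) ^ k)⁻¹) ^ 2 +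
        ((F.P K).L : ℝ) ^ j * (η * (8 * 3800 * ((((F.P K).d + 2) * (F.P K).L : ℕ) : ℝ) ^ 2)⁻¹)) :=
    mul_le_mul_of_nonneg_left (add_le_add le_rfl htle) hD0
  have ha0 : 0 ≤ 64 * ((F.P K).d : ℝ) * t := by positivity
  have hale : 64 * ((F.P K).d : ℝ) * t ≤ 64 * ((F.P K).d : ℝ) * (((F.P K).L : ℝ) ^ j * (η * (8 * 3800 * ((((F.P K).d + 2) * (F.P K).L : ℕ) : ℝ) ^ 2)⁻¹)) :=
    mul_le_mul_of_nonneg_left htle (by positivity)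
  have hfin := hmain.trans (omegaForm_mono hx0 ha0 hxle hale)
  rw [hFL] at hfin ⊢; exact hfin

end Member

end Summit.QuantumFields.YangMills.Theorems.HalvingOmegaRowMember

end
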